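import Literature.AlgebraicGeometry.Resolution.StrictTransformTransport
import Literature.AlgebraicGeometry.Resolution.StrictTransformFlatteningBaseReduction
import Literature.AlgebraicGeometry.Resolution.BlowupsProduct
import Literature.AlgebraicGeometry.Morphisms.SeparatedGluing
import Mathlib.AlgebraicGeometry.Morphisms.Proper
import HarnessLib

/-!
# Gluing two schemes containing `U` after `U`-admissible blowing ups (Stacks 0F3X, conditional
# on Raynaud–Gruson flattening)

Topic: `Literature/AlgebraicGeometry/Resolution`. The Stacks Project, Tag 0F3X (More on Flatness,
Lemma 38.33.4): "Let `S` be a quasi-compact and quasi-separated scheme. Let `U → X₁` and `U → X₂`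
be open immersions of schemes over `S` and assume `U, X₁, X₂` of finite type and separated over
`S`. Then there exists a commutative diagram `X₁' → X ← X₂'` over `X₁ ← U → X₂` of schemes over
`S` where `Xᵢ' → Xᵢ` is a `U`-admissible blowup, `Xᵢ' → X` is an open immersion, and `X` is
separated and finite type over `S`." This is the gluing step of the two-piece induction
(Tag 0F40) of the proof of Nagata's compactification theorem (Tag 0F41).

PROVED, conditionally on the named fact `Stacks081R` (Raynaud–Gruson flattening, entering through
Tag 081S = `stacks081S_of_stacks081R`), following the printed proof: `X₁₂ =` the
scheme-theoretic image of `U → X₁ ×_S X₂`, whose projections `pᵢ : X₁₂ → Xᵢ` are isomorphisms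
over `U` (`GraphClosure.isIso_morphismRestrict`); by 081S, `U`-admissible blowing ups
`cᵢ : Xᵢⁱ → Xᵢ` such that the strict transform `Tᵢ = X₁₂ⁱ` of `X₁₂` is an open `tᵢ : Tᵢ → Xᵢⁱ`, and
`qᵢ : Tᵢ → X₁₂` is the blowing up in `pᵢ⁻¹𝓘ᵢ` (Tag 080E); the blowing up `R` of `X₁₂` in
`p₁⁻¹𝓘₁ · p₂⁻¹𝓘₂` dominates both (`IsBlowup.comp`, Tag 080A: `rᵢ : R → Tᵢ`); the centre of `r₁`
extends from the open `T₁ ⊆ X₁¹` to a `U`-admissible centre on `X₁¹` (Tag 080M,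
`exists_fg_comap_ι_eq_of_disjoint`), whose blowing up `d₁ : X₁' → X₁¹` restricts over `T₁` to
`r₁` (uniqueness of blowing ups), so that `R` is an open `m₁ : R → X₁'`; same on the other side;
`X = X₁' ⨿_R X₂'` (push-out along the open immersions `m₁, m₂`), separated over `S` by the
criterion of Tag 0F3U (`Morphisms.isSeparated_pushoutDesc`: the graph `R → X₁' ×_S X₂'` has
closed image, being universally closed as `R → X₁₂ → X₁ ×_S X₂` is proper and
`X₁' ×_S X₂' → X₁ ×_S X₂` is separated), of finite type (`Limits.locallyOfFiniteType_pushoutDesc`,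
`Limits.quasiCompact_pushoutDesc`). All blowing ups are normalised (centres supported on exactly
the complement of `U`, `StrictTransformTransport.lean`), so that `bᵢ = dᵢ ≫ cᵢ` is again a
normalised `U`-admissible blowing up (`IsBlowup.normalised_comp`) and `U` lifts to `Xᵢ'`.

* `ext_of_isIso_morphismRestrict` — two morphisms which agree after `b` and land over an open
  over which `b` is an isomorphism are equal;
* `GluingData g₁ g₂ u₁ u₂` — the output of Tag 0F3X as a structure (the schemes `X₁', X₂', X`,
  the normalised blowing ups `bᵢ`, the open immersions `Xᵢ' → X`, the structure morphism
  `X → S`, separated and of finite type, and the lifts `U → Xᵢ'`, with all compatibilities);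
* `stacks0F3X_of_stacks081R` — **Stacks 0F3X** (conditional on `Stacks081R`):
  `Nonempty (GluingData g₁ g₂ u₁ u₂)`.

## References

* The Stacks Project, Tag 0F3X (Lemma 38.33.4) and its proof; Tags 081S, 080A, 080E, 080M, 0F3U.
  [StacksProject]
-/

noncomputable section

-- Mathlib's pull-back API is stated through `abbrev`s over `limit`; as in Mathlib's own
-- algebraic-geometry files we let `simp`/unification see through them.
set_option backward.isDefEq.respectTransparency false

open CategoryTheory CategoryTheory.Limits AlgebraicGeometry TopologicalSpace
open Literature.AlgebraicGeometry.Morphisms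

namespace Literature.AlgebraicGeometry.Resolution

universe u

/-! ## Generalities -/

section General

variable {T X' X : Scheme.{u}}

/-- **Two morphisms which agree after `b : X' → X` and land, after `b`, in an open `O` over which
`b` is an isomorphism, are equal.** [folklore] -/
theorem ext_of_isIso_morphismRestrict (b : X' ⟶ X) (O : X.Opens) [IsIso (b ∣_ O)] {a a' : T ⟶ X'}
    (h : a ≫ b = a' ≫ b) (hO : Set.range (a ≫ b) ⊆ (O : Set X)) : a = a' := by
  have ha : Set.range a ⊆ Set.range (b ⁻¹ᵁ O).ι := by
    rw [Scheme.Opens.range_ι]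
    rintro _ ⟨t, rfl⟩
    exact hO ⟨t, rfl⟩
  have ha' : Set.range a' ⊆ Set.range (b ⁻¹ᵁ O).ι := by
    rw [Scheme.Opens.range_ι]
    rintro _ ⟨t, rfl⟩
    show (a' ≫ b) t ∈ O
    rw [← h]
    exact hO ⟨t, rfl⟩
  rw [← IsOpenImmersion.lift_fac (b ⁻¹ᵁ O).ι a ha, ← IsOpenImmersion.lift_fac (b ⁻¹ᵁ O).ι a' ha']
  congr 1
  rw [← cancel_mono (b ∣_ O), ← cancel_mono O.ι, Category.assoc, Category.assoc, morphismRestrict_ι,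
    IsOpenImmersion.lift_fac_assoc, IsOpenImmersion.lift_fac_assoc, h]

/-- **Lifting along an isomorphism locus**: a morphism `u : T → X` landing in an open `O` over
which `b : X' → X` is an isomorphism lifts to `X'`. [folklore] -/
def liftOfIsIsoMorphismRestrict (b : X' ⟶ X) (O : X.Opens) [IsIso (b ∣_ O)] (u : T ⟶ X)
    (hu : Set.range u ⊆ (O : Set X)) : T ⟶ X' :=
  IsOpenImmersion.lift O.ι u (by rwa [Scheme.Opens.range_ι]) ≫ inv (b ∣_ O) ≫ (b ⁻¹ᵁ O).ι

/-- The lift composed with `b` is `u`. [folklore] -/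
@[reassoc (attr := simp)]
theorem liftOfIsIsoMorphismRestrict_comp (b : X' ⟶ X) (O : X.Opens) [IsIso (b ∣_ O)] (u : T ⟶ X)
    (hu : Set.range u ⊆ (O : Set X)) : liftOfIsIsoMorphismRestrict b O u hu ≫ b = u := by
  rw [liftOfIsIsoMorphismRestrict, Category.assoc, Category.assoc, ← morphismRestrict_ι,
    IsIso.inv_hom_id_assoc, IsOpenImmersion.lift_fac]

/-- The lift of an open immersion is an open immersion. [folklore] -/
theorem isOpenImmersion_liftOfIsIsoMorphismRestrict (b : X' ⟶ X) (O : X.Opens) [IsIso (b ∣_ O)]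
    (u : T ⟶ X) [IsOpenImmersion u] (hu : Set.range u ⊆ (O : Set X)) :
    IsOpenImmersion (liftOfIsIsoMorphismRestrict b O u hu) := by
  haveI : IsOpenImmersion (IsOpenImmersion.lift O.ι u (by rwa [Scheme.Opens.range_ι])) := by
    have h : IsOpenImmersion (IsOpenImmersion.lift O.ι u (by rwa [Scheme.Opens.range_ι]) ≫ O.ι) := by
      rw [IsOpenImmersion.lift_fac]; infer_instance
    exact .of_comp _ O.ι
  unfold liftOfIsIsoMorphismRestrict
  infer_instance

/-- The lift lands in `b⁻¹(O)`. [folklore] -/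
theorem range_liftOfIsIsoMorphismRestrict (b : X' ⟶ X) (O : X.Opens) [IsIso (b ∣_ O)] (u : T ⟶ X)
    (hu : Set.range u ⊆ (O : Set X)) :
    Set.range (liftOfIsIsoMorphismRestrict b O u hu) ⊆ ((b ⁻¹ᵁ O : X'.Opens) : Set X') := by
  rintro _ ⟨t, rfl⟩
  show b (liftOfIsIsoMorphismRestrict b O u hu t) ∈ O
  rw [← Scheme.Hom.comp_apply, liftOfIsIsoMorphismRestrict_comp]
  exact hu ⟨t, rfl⟩

end General

/-! ## The output of Stacks 0F3X -/

/-- **The data produced by Stacks 0F3X** for open immersions `uᵢ : U → Xᵢ` over `S`: normalised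
`U`-admissible blowing ups `bᵢ : Xᵢ' → Xᵢ` (blowing ups in ideal sheaves `𝓠ᵢ` of finite type
with `V(𝓠ᵢ) = Xᵢ ∖ uᵢ(U)`), a scheme `X` with open immersions `iᵢ : Xᵢ' → X` and a separated
morphism of finite type `g : X → S` compatible with `Xᵢ → S`, and the lifts `uᵢ' : U → Xᵢ'`, open
immersions agreeing in `X`. [cite: StacksProject, Tag 0F3X] -/
structure GluingData {S U X₁ X₂ : Scheme.{u}} (g₁ : X₁ ⟶ S) (g₂ : X₂ ⟶ S) (u₁ : U ⟶ X₁)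
    (u₂ : U ⟶ X₂) where
  /-- the blown-up schemes and the glued scheme -/
  (X₁' X₂' X : Scheme.{u})
  /-- the blowing ups -/
  (b₁ : X₁' ⟶ X₁) (b₂ : X₂' ⟶ X₂)
  /-- their centres -/
  (Q₁ : X₁.IdealSheafData) (Q₂ : X₂.IdealSheafData)
  /-- the open immersions into the glued scheme -/
  (i₁ : X₁' ⟶ X) (i₂ : X₂' ⟶ X)
  /-- the structure morphism of the glued scheme -/
  (g : X ⟶ S)
  /-- the lifts of `U` -/
  (u₁' : U ⟶ X₁') (u₂' : U ⟶ X₂')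
  fg₁ : ∀ W : X₁.affineOpens, (Q₁.ideal W).FG
  fg₂ : ∀ W : X₂.affineOpens, (Q₂.ideal W).FG
  supp₁ : (Q₁.support : Set X₁) = (Set.range u₁)ᶜ
  supp₂ : (Q₂.support : Set X₂) = (Set.range u₂)ᶜ
  isBlowup₁ : IsBlowup b₁ Q₁
  isBlowup₂ : IsBlowup b₂ Q₂
  [isOpenImmersion₁ : IsOpenImmersion i₁]
  [isOpenImmersion₂ : IsOpenImmersion i₂]
  [isSeparated : IsSeparated g]
  [locallyOfFiniteType : LocallyOfFiniteType g]
  [quasiCompact : QuasiCompact g]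
  i₁_g : i₁ ≫ g = b₁ ≫ g₁
  i₂_g : i₂ ≫ g = b₂ ≫ g₂
  u₁'_b₁ : u₁' ≫ b₁ = u₁
  u₂'_b₂ : u₂' ≫ b₂ = u₂
  u₁'_i₁ : u₁' ≫ i₁ = u₂' ≫ i₂
  [isOpenImmersion_u₁' : IsOpenImmersion u₁']
  [isOpenImmersion_u₂' : IsOpenImmersion u₂']
  /-- the two open immersions cover the glued scheme (added 2026-08-16: needed to conclude
  properness of `X → S` by the valuative criterion in Tag 0F40) -/
  range_i₁_union_range_i₂ : Set.range i₁ ∪ Set.range i₂ = Set.univ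

/-! ## Stacks 0F3X -/

section Main

variable {S U X₁ X₂ : Scheme.{u}} [CompactSpace S] [QuasiSeparatedSpace S] (g₁ : X₁ ⟶ S) (g₂ : X₂ ⟶ S)
  [IsSeparated g₁] [LocallyOfFiniteType g₁] [QuasiCompact g₁]
  [IsSeparated g₂] [LocallyOfFiniteType g₂] [QuasiCompact g₂]
  (u₁ : U ⟶ X₁) (u₂ : U ⟶ X₂) [IsOpenImmersion u₁] [IsOpenImmersion u₂] [QuasiCompact u₁]
  (hu : u₁ ≫ g₁ = u₂ ≫ g₂)

/-- **One side of Stacks 0F3X.** For the scheme-theoretic image `Z` of `U → X₁ ×_S X₂` with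
projection `p : Z → Xᵢ` (an isomorphism over `O = uᵢ(U)`), Tag 081S provides a normalised
`O`-admissible blowing up `c : Xⁱ → Xᵢ` in `𝓘` such that the strict transform `T` of `p` is an
open `t : T → Xⁱ`; `q : T → Z` is the blowing up in `p⁻¹𝓘`. Given moreover an ideal sheaf `𝓚`
of finite type on `T` supported away from the points of `T` over `O`, there is a normalised
`O`-admissible blowing up `b = d ≫ c : X' → Xᵢ` and an open immersion `m : R → X'` from the
blowing up `r : R → T` of `T` in `𝓚` with `m ≫ d = r ≫ t`. This packages the steps "choose a
`U`-admissible blowup `Xᵢⁱ → Xᵢ` such that the strict transform `X₁₂ⁱ` is isomorphic to an open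
subscheme of `Xᵢⁱ`" and "since `X₁₂ⁱ ⊂ Xᵢⁱ` is an open we may choose a `U`-admissible blowup
`Xᵢ' → Xᵢⁱ` restricting to `X₁₂' → X₁₂ⁱ`" of the printed proof. [cite: StacksProject, Tag 0F3X (proof)] -/
theorem exists_side (hRG : Stacks081R.{u}) {Z Xi : Scheme.{u}} [CompactSpace Xi]
    [QuasiSeparatedSpace Xi] (p : Z ⟶ Xi) [IsSeparated p] [QuasiCompact p] [LocallyOfFiniteType p]
    (O : Xi.Opens) (hO : IsCompact (O : Set Xi)) [IsIso (p ∣_ O)] :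
    ∃ (I : Xi.IdealSheafData) (Xii : Scheme.{u}) (c : Xii ⟶ Xi),
      (∀ W : Xi.affineOpens, (I.ideal W).FG) ∧ (I.support : Set Xi) = (O : Set Xi)ᶜ ∧ IsBlowup c I ∧
      IsOpenImmersion (blowupStrictTransformMap p c I) ∧
      ∀ (K : (blowupStrictTransform p c I).IdealSheafData),
        (∀ W, (K.ideal W).FG) →
        Disjoint (((blowupStrictTransformι p c I ≫ pullback.fst p c) ⁻¹ᵁ (p ⁻¹ᵁ O) :
          (blowupStrictTransform p c I).Opens) : Set (blowupStrictTransform p c I)) (K.support) →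
        ∀ {R : Scheme.{u}} (r : R ⟶ blowupStrictTransform p c I), IsBlowup r K →
        ∃ (Q : Xi.IdealSheafData) (X' : Scheme.{u}) (d : X' ⟶ Xii) (m : R ⟶ X'),
          (∀ W : Xi.affineOpens, (Q.ideal W).FG) ∧ (Q.support : Set Xi) = (O : Set Xi)ᶜ ∧
          IsBlowup (d ≫ c) Q ∧ IsOpenImmersion m ∧ m ≫ d = r ≫ blowupStrictTransformMap p c I := by
  obtain ⟨I, Xii, c, hIfg, hIsupp, hc, hopen⟩ := stacks081S_of_stacks081R hRG p O hO
  haveI := hopen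
  haveI : IsProper c := IsBlowup.isProper_of_fg hIfg hc
  haveI : CompactSpace Xii := QuasiCompact.compactSpace_of_compactSpace c
  haveI : QuasiSeparatedSpace Xii := quasiSeparatedSpace_of_quasiSeparated c
  refine ⟨I, Xii, c, hIfg, hIsupp, hc, hopen, fun K hKfg hKdisj R r hr => ?_⟩
  set t := blowupStrictTransformMap p c I with ht
  set q := blowupStrictTransformι p c I ≫ pullback.fst p c with hq
  have htc : t ≫ c = q ≫ p := by
    rw [hq, Category.assoc, pullback.condition, ← Category.assoc]; rfl
  -- the open `V = t(T)` and `τ : T ≅ V`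
  set V : Xii.Opens := t.opensRange with hV
  set τ := t.isoOpensRange with hτ
  -- `T` is quasi-compact, so `V` is
  haveI : CompactSpace Z := by
    haveI : IsIso (p ∣_ O) := inferInstance
    -- `Z` is quasi-compact over the quasi-compact `Xi`
    exact QuasiCompact.compactSpace_of_compactSpace p
  have hE : IsEffectiveCartier (I.comap c) := hc.isEffectiveCartier
  haveI : IsProper (pullback.fst p c) := inferInstance
  haveI : CompactSpace (blowupStrictTransform p c I) :=
    QuasiCompact.compactSpace_of_compactSpace q
  have hVc : IsCompact (V : Set Xii) := isCompact_range t.continuous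
  -- the centre `𝓚` moved to `V` does not meet the part of `Xⁱ` over `O`
  set K' := K.comap τ.inv with hK'
  have hK'fg : ∀ W, (K'.ideal W).FG := fg_ideal_comap τ.inv hKfg
  have hK'disj : Disjoint ((V.ι ⁻¹ᵁ (c ⁻¹ᵁ O) : (V : Scheme.{u}).Opens) : Set (V : Scheme.{u}))
      (K'.support : Set (V : Scheme.{u})) := by
    refine Set.disjoint_left.mpr fun v hv hvK => ?_
    rw [hK', Scheme.IdealSheafData.support_comap] at hvK
    refine Set.disjoint_left.mp hKdisj ?_ hvK
    -- `q (τ⁻¹ v)` lies over `O` because `c (t (τ⁻¹ v)) = c v` does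
    show p (q (τ.inv v)) ∈ O
    have h1 : t (τ.inv v) = V.ι v := by
      rw [← Scheme.Hom.comp_apply, hτ, Scheme.Hom.isoOpensRange_inv_comp]
    rw [← Scheme.Hom.comp_apply, ← htc, Scheme.Hom.comp_apply, h1]
    exact hv
  -- extend it to a `c⁻¹O`-admissible centre `G` on `Xⁱ` (Stacks 080M) and blow up, normalised
  obtain ⟨G, hGfg, hGcomap, hGO⟩ := exists_fg_comap_ι_eq_of_disjoint (c ⁻¹ᵁ O) (c.isCompact_preimage hO)
    V hVc K' hK'fg hK'disj
  obtain ⟨X', d, hd⟩ := exists_isBlowup Xii G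
  obtain ⟨hd', hG'fg, hG'supp, Q, hQfg, hQsupp, hbQ⟩ := hc.normalised_comp hIfg hIsupp hd hGfg hGO
  -- over `V`, `d` is the blowing up of `V` in `K' · L`, as is `r ≫ τ`
  set L := (I.comap c).comap V.ι with hL
  have hLc : IsEffectiveCartier L := hE.comap_of_isOpenImmersion V.ι
  have hGV : (G * I.comap c).comap V.ι = K' * L := by rw [comap_mul, hGcomap]
  have hdV : IsBlowup (d ∣_ V) (K' * L) := hGV ▸ hd'.restrict V
  have hrV : IsBlowup (r ≫ τ.hom) (K' * L) := (hr.comp_iso τ).mul_of_isEffectiveCartier hLc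
  obtain ⟨ε, hε, -⟩ := hrV.unique hdV
  refine ⟨Q, X', d, ε.hom ≫ (d ⁻¹ᵁ V).ι, hQfg, hQsupp, hbQ, inferInstance, ?_⟩
  rw [Category.assoc, ← morphismRestrict_ι, ← Category.assoc ε.hom, hε, Category.assoc]
  show r ≫ t.isoOpensRange.hom ≫ t.opensRange.ι = r ≫ t
  rw [Scheme.Hom.isoOpensRange_hom_ι]

include hu in
/-- **Stacks 0F3X, conditional on Raynaud–Gruson flattening (`Stacks081R`).** For open
immersions `uᵢ : U → Xᵢ` over a quasi-compact quasi-separated `S` (`u₁ ≫ g₁ = u₂ ≫ g₂`), with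
`Xᵢ → S` separated and of finite type and `U` quasi-compact, there are `U`-admissible blowing ups
`Xᵢ' → Xᵢ`, a scheme `X` separated and of finite type over `S` and open immersions `Xᵢ' → X`
over `S` under which the two lifts of `U` agree (`GluingData`). See the module docstring for the
proof. [cite: StacksProject, Tag 0F3X] -/
theorem stacks0F3X_of_stacks081R (hRG : Stacks081R.{u}) : Nonempty (GluingData g₁ g₂ u₁ u₂) := by
  haveI : CompactSpace X₁ := QuasiCompact.compactSpace_of_compactSpace g₁
  haveI : CompactSpace X₂ := QuasiCompact.compactSpace_of_compactSpace g₂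
  haveI : QuasiSeparatedSpace X₁ := quasiSeparatedSpace_of_quasiSeparated g₁
  haveI : QuasiSeparatedSpace X₂ := quasiSeparatedSpace_of_quasiSeparated g₂
  haveI : CompactSpace U := QuasiCompact.compactSpace_of_compactSpace u₁
  /- Step A: the scheme-theoretic image `Z` of `U → X₁ ×_S X₂` and its projections -/
  set γ : U ⟶ pullback g₁ g₂ := pullback.lift u₁ u₂ hu with hγ
  have hγ₁ : γ ≫ pullback.fst g₁ g₂ = u₁ := pullback.lift_fst _ _ _
  have hγ₂ : γ ≫ pullback.snd g₁ g₂ = u₂ := pullback.lift_snd _ _ _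
  haveI : QuasiSeparatedSpace (↥(pullback g₁ g₂ : Scheme.{u})) :=
    quasiSeparatedSpace_of_quasiSeparated (pullback.snd g₁ g₂)
  haveI : QuasiCompact γ := inferInstance
  set ι := γ.imageι with hι
  set s := γ.toImage with hs
  set p₁ : γ.image ⟶ X₁ := ι ≫ pullback.fst g₁ g₂ with hp₁
  set p₂ : γ.image ⟶ X₂ := ι ≫ pullback.snd g₁ g₂ with hp₂
  haveI : IsSeparated p₁ := inferInstance
  haveI : IsSeparated p₂ := inferInstance
  have hpg : p₁ ≫ g₁ = p₂ ≫ g₂ := by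
    simp only [hp₁, hp₂, Category.assoc, pullback.condition]
  have hsp₁ : s ≫ p₁ = u₁ := by rw [hs, hp₁, Scheme.Hom.toImage_imageι_assoc, hγ₁]
  have hsp₂ : s ≫ p₂ = u₂ := by rw [hs, hp₂, Scheme.Hom.toImage_imageι_assoc, hγ₂]
  haveI : LocallyOfFiniteType p₁ := inferInstance
  haveI : LocallyOfFiniteType p₂ := inferInstance
  haveI : QuasiCompact p₁ := inferInstance
  haveI : QuasiCompact p₂ := inferInstance
  set O₁ : X₁.Opens := u₁.opensRange with hO₁
  set O₂ : X₂.Opens := u₂.opensRange with hO₂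
  have hO₁c : IsCompact (O₁ : Set X₁) := isCompact_range u₁.continuous
  have hO₂c : IsCompact (O₂ : Set X₂) := isCompact_range u₂.continuous
  haveI : QuasiCompact u₂ := inferInstance
  haveI : IsIso (p₁ ∣_ O₁) := GraphClosure.isIso_morphismRestrict u₁ (pullback.fst g₁ g₂) γ hγ₁
  haveI : IsIso (p₂ ∣_ O₂) := GraphClosure.isIso_morphismRestrict u₂ (pullback.snd g₁ g₂) γ hγ₂
  have hrange₁ : Set.range s = ((p₁ ⁻¹ᵁ O₁ : (γ.image).Opens) : Set γ.image) :=
    (GraphClosure.isOpenImmersion_toImage_and_range u₁ (pullback.fst g₁ g₂) γ hγ₁).2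
  have hrange₂ : Set.range s = ((p₂ ⁻¹ᵁ O₂ : (γ.image).Opens) : Set γ.image) :=
    (GraphClosure.isOpenImmersion_toImage_and_range u₂ (pullback.snd g₁ g₂) γ hγ₂).2
  /- Step B (081S on both sides) -/
  obtain ⟨I₁, X₁i, c₁, hI₁fg, hI₁supp, hc₁, hopen₁, hside₁⟩ := exists_side hRG p₁ O₁ hO₁c
  obtain ⟨I₂, X₂i, c₂, hI₂fg, hI₂supp, hc₂, hopen₂, hside₂⟩ := exists_side hRG p₂ O₂ hO₂c
  haveI : IsProper c₁ := IsBlowup.isProper_of_fg hI₁fg hc₁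
  haveI : IsProper c₂ := IsBlowup.isProper_of_fg hI₂fg hc₂
  set t₁ := blowupStrictTransformMap p₁ c₁ I₁ with ht₁
  set t₂ := blowupStrictTransformMap p₂ c₂ I₂ with ht₂
  set q₁ := blowupStrictTransformι p₁ c₁ I₁ ≫ pullback.fst p₁ c₁ with hq₁
  set q₂ := blowupStrictTransformι p₂ c₂ I₂ ≫ pullback.fst p₂ c₂ with hq₂
  haveI : IsProper q₁ := inferInstance
  haveI : IsProper q₂ := inferInstance
  have htc₁ : t₁ ≫ c₁ = q₁ ≫ p₁ := by
    rw [ht₁, hq₁, Category.assoc, pullback.condition]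
    change (blowupStrictTransformι p₁ c₁ I₁ ≫ pullback.snd p₁ c₁) ≫ c₁ = _
    rw [Category.assoc]
  have htc₂ : t₂ ≫ c₂ = q₂ ≫ p₂ := by
    rw [ht₂, hq₂, Category.assoc, pullback.condition]
    change (blowupStrictTransformι p₂ c₂ I₂ ≫ pullback.snd p₂ c₂) ≫ c₂ = _
    rw [Category.assoc]
  set J₁ := I₁.comap p₁ with hJ₁
  set J₂ := I₂.comap p₂ with hJ₂
  have hq₁b : IsBlowup q₁ J₁ := isBlowup_blowupStrictTransform p₁ c₁ I₁ hc₁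
  have hq₂b : IsBlowup q₂ J₂ := isBlowup_blowupStrictTransform p₂ c₂ I₂ hc₂
  have hJ₁fg : ∀ W, (J₁.ideal W).FG := fg_ideal_comap p₁ hI₁fg
  have hJ₂fg : ∀ W, (J₂.ideal W).FG := fg_ideal_comap p₂ hI₂fg
  have hJ₁supp : (J₁.support : Set γ.image) = ((p₁ ⁻¹ᵁ O₁ : (γ.image).Opens) : Set γ.image)ᶜ := by
    rw [hJ₁, Scheme.IdealSheafData.support_comap]
    ext x
    change p₁ x ∈ (I₁.support : Set X₁) ↔ ¬ (p₁ x ∈ (O₁ : Set X₁))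
    rw [hI₁supp, Set.mem_compl_iff]
  have hJ₂supp : (J₂.support : Set γ.image) = ((p₁ ⁻¹ᵁ O₁ : (γ.image).Opens) : Set γ.image)ᶜ := by
    rw [hJ₂, Scheme.IdealSheafData.support_comap, ← hrange₁, hrange₂]
    ext x
    change p₂ x ∈ (I₂.support : Set X₂) ↔ ¬ (p₂ x ∈ (O₂ : Set X₂))
    rw [hI₂supp, Set.mem_compl_iff]
  /- Step C: the common refinement `R = Bl_{J₁ J₂}(Z)` -/
  obtain ⟨R, r₁, hr₁⟩ := exists_isBlowup (blowupStrictTransform p₁ c₁ I₁) (J₂.comap q₁)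
  obtain ⟨R', r₂, hr₂⟩ := exists_isBlowup (blowupStrictTransform p₂ c₂ I₂) (J₁.comap q₂)
  have hρ₁ : IsBlowup (r₁ ≫ q₁) (J₁ * J₂) := hq₁b.comp hr₁
  have hρ₂ : IsBlowup (r₂ ≫ q₂) (J₁ * J₂) := by rw [mul_comm]; exact hq₂b.comp hr₂
  obtain ⟨e, he, -⟩ := hρ₁.unique hρ₂
  haveI : IsProper r₁ := IsBlowup.isProper_of_fg (fg_ideal_comap q₁ hJ₂fg) hr₁
  /- Step D: blow up `X₁ⁱ`, `X₂ⁱ` further so that `R` becomes an open of both -/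
  have hK₁disj : Disjoint (((blowupStrictTransformι p₁ c₁ I₁ ≫ pullback.fst p₁ c₁) ⁻¹ᵁ (p₁ ⁻¹ᵁ O₁) :
      (blowupStrictTransform p₁ c₁ I₁).Opens) : Set (blowupStrictTransform p₁ c₁ I₁))
      ((J₂.comap q₁).support) := by
    rw [Scheme.IdealSheafData.support_comap]
    refine Set.disjoint_left.mpr fun x hx hx' => ?_
    have hx'' : q₁ x ∈ (J₂.support : Set γ.image) := hx'
    rw [hJ₂supp] at hx''
    exact hx'' hx
  have hK₂disj : Disjoint (((blowupStrictTransformι p₂ c₂ I₂ ≫ pullback.fst p₂ c₂) ⁻¹ᵁ (p₂ ⁻¹ᵁ O₂) :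
      (blowupStrictTransform p₂ c₂ I₂).Opens) : Set (blowupStrictTransform p₂ c₂ I₂))
      ((J₁.comap q₂).support) := by
    rw [Scheme.IdealSheafData.support_comap]
    refine Set.disjoint_left.mpr fun x hx hx' => ?_
    have hx'' : q₂ x ∈ (J₁.support : Set γ.image) := hx'
    rw [hJ₁supp] at hx''
    have hx3 : q₂ x ∈ ((p₁ ⁻¹ᵁ O₁ : (γ.image).Opens) : Set γ.image) := by
      rw [← hrange₁, hrange₂]; exact hx
    exact hx'' hx3
  obtain ⟨Q₁, X₁', d₁, m₁, hQ₁fg, hQ₁supp, hb₁, hm₁, hm₁d⟩ :=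
    hside₁ (J₂.comap q₁) (fg_ideal_comap q₁ hJ₂fg) hK₁disj r₁ hr₁
  obtain ⟨Q₂, X₂', d₂, m₂, hQ₂fg, hQ₂supp, hb₂, hm₂, hm₂d⟩ :=
    hside₂ (J₁.comap q₂) (fg_ideal_comap q₂ hJ₁fg) hK₂disj r₂ hr₂
  haveI := hm₁
  haveI := hm₂
  obtain ⟨b₁, hb₁def⟩ : ∃ b : X₁' ⟶ X₁, b = d₁ ≫ c₁ := ⟨_, rfl⟩
  obtain ⟨b₂, hb₂def⟩ : ∃ b : X₂' ⟶ X₂, b = d₂ ≫ c₂ := ⟨_, rfl⟩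
  rw [← hb₁def] at hb₁
  rw [← hb₂def] at hb₂
  haveI : IsProper b₁ := IsBlowup.isProper_of_fg hQ₁fg hb₁
  haveI : IsProper b₂ := IsBlowup.isProper_of_fg hQ₂fg hb₂
  haveI : CompactSpace X₁' := QuasiCompact.compactSpace_of_compactSpace b₁
  haveI : CompactSpace X₂' := QuasiCompact.compactSpace_of_compactSpace b₂
  set m₂' := e.hom ≫ m₂ with hm₂'
  haveI : IsOpenImmersion m₂' := by rw [hm₂']; infer_instance
  -- the key equations
  have hm₁b : m₁ ≫ b₁ = (r₁ ≫ q₁) ≫ p₁ := by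
    rw [hb₁def, ← Category.assoc, hm₁d, Category.assoc, htc₁]
    simp only [hq₁, Category.assoc]
  have hm₂b : m₂' ≫ b₂ = (r₁ ≫ q₁) ≫ p₂ := by
    rw [hb₂def, hm₂', Category.assoc, ← Category.assoc m₂, hm₂d, Category.assoc, htc₂,
      ← Category.assoc r₂ q₂ p₂, ← Category.assoc e.hom (r₂ ≫ q₂) p₂, he]
  have w : m₁ ≫ b₁ ≫ g₁ = m₂' ≫ b₂ ≫ g₂ := by
    rw [← Category.assoc, hm₁b, ← Category.assoc m₂', hm₂b, Category.assoc, Category.assoc, hpg]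
    simp only [Category.assoc]
  /- Step E: glue -/
  haveI := Limits.isOpenImmersion_inl m₁ m₂'
  haveI := Limits.isOpenImmersion_inr m₁ m₂'
  have hclosed : IsClosed (Set.range (pullback.lift m₁ m₂' w : R ⟶ pullback (b₁ ≫ g₁) (b₂ ≫ g₂))) := by
    set Γ := pullback.lift m₁ m₂' w with hΓ
    set β := pullback.map (b₁ ≫ g₁) (b₂ ≫ g₂) g₁ g₂ b₁ b₂ (𝟙 S)
      (by rw [Category.comp_id]) (by rw [Category.comp_id]) with hβ
    haveI : IsSeparated β :=
      MorphismProperty.pullbackMap (P := @IsSeparated) (f := b₁ ≫ g₁) (g := b₂ ≫ g₂)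
        (f' := g₁) (g' := g₂) (i₁ := b₁) (i₂ := b₂) inferInstance inferInstance rfl rfl
    have hΓβ : Γ ≫ β = (r₁ ≫ q₁) ≫ ι := by
      apply pullback.hom_ext
      · rw [Category.assoc, Category.assoc, hβ, pullback.lift_fst, ← Category.assoc, hΓ, pullback.lift_fst,
          hm₁b]
      · rw [Category.assoc, Category.assoc, hβ, pullback.lift_snd, ← Category.assoc, hΓ, pullback.lift_snd,
          hm₂b]
    haveI : UniversallyClosed (Γ ≫ β) := by rw [hΓβ]; infer_instance
    haveI : UniversallyClosed Γ := .of_comp_of_isSeparated Γ β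
    exact Γ.isClosedMap.isClosed_range
  haveI : IsSeparated (pushout.desc (b₁ ≫ g₁) (b₂ ≫ g₂) w) :=
    isSeparated_pushoutDesc m₁ m₂' _ _ w hclosed
  haveI : LocallyOfFiniteType (pushout.desc (b₁ ≫ g₁) (b₂ ≫ g₂) w) :=
    Limits.locallyOfFiniteType_pushoutDesc m₁ m₂' _ _ w
  haveI : QuasiCompact (pushout.desc (b₁ ≫ g₁) (b₂ ≫ g₂) w) :=
    Limits.quasiCompact_pushoutDesc m₁ m₂' _ _ w
  /- Step F: the lifts of `U` -/
  haveI : IsIso (b₁ ∣_ O₁) := IsBlowup.isIso_morphismRestrict_of_support_eq hb₁ hQ₁supp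
  haveI : IsIso (b₂ ∣_ O₂) := IsBlowup.isIso_morphismRestrict_of_support_eq hb₂ hQ₂supp
  have hu₁O : Set.range u₁ ⊆ (O₁ : Set X₁) := subset_of_eq (Scheme.Hom.coe_opensRange u₁).symm
  have hu₂O : Set.range u₂ ⊆ (O₂ : Set X₂) := subset_of_eq (Scheme.Hom.coe_opensRange u₂).symm
  set u₁' := liftOfIsIsoMorphismRestrict b₁ O₁ u₁ hu₁O with hu₁'
  set u₂' := liftOfIsIsoMorphismRestrict b₂ O₂ u₂ hu₂O with hu₂'
  haveI : IsOpenImmersion u₁' := isOpenImmersion_liftOfIsIsoMorphismRestrict _ _ _ _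
  haveI : IsOpenImmersion u₂' := isOpenImmersion_liftOfIsIsoMorphismRestrict _ _ _ _
  -- `U → R` through the isomorphism locus of `R → Z`
  have hρsupp : ((J₁ * J₂).support : Set γ.image) = ((p₁ ⁻¹ᵁ O₁ : (γ.image).Opens) : Set γ.image)ᶜ := by
    rw [Scheme.IdealSheafData.support_mul, TopologicalSpace.Closeds.coe_sup, hJ₁supp, hJ₂supp, Set.union_self]
  haveI : IsIso ((r₁ ≫ q₁) ∣_ (p₁ ⁻¹ᵁ O₁)) := IsBlowup.isIso_morphismRestrict_of_support_eq hρ₁ hρsupp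
  set wR := liftOfIsIsoMorphismRestrict (r₁ ≫ q₁) (p₁ ⁻¹ᵁ O₁) s (subset_of_eq hrange₁) with hwR
  have hwRq : wR ≫ r₁ ≫ q₁ = s := liftOfIsIsoMorphismRestrict_comp _ _ _ _
  have hw₁ : wR ≫ m₁ = u₁' := by
    refine ext_of_isIso_morphismRestrict b₁ O₁ ?_ ?_
    · rw [Category.assoc, hm₁b, ← Category.assoc, hwRq, hu₁', liftOfIsIsoMorphismRestrict_comp, hsp₁]
    · rw [Category.assoc, hm₁b, ← Category.assoc, hwRq, hsp₁]
      exact hu₁O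
  have hw₂ : wR ≫ m₂' = u₂' := by
    refine ext_of_isIso_morphismRestrict b₂ O₂ ?_ ?_
    · rw [Category.assoc, hm₂b, ← Category.assoc, hwRq, hu₂', liftOfIsIsoMorphismRestrict_comp, hsp₂]
    · rw [Category.assoc, hm₂b, ← Category.assoc, hwRq, hsp₂]
      exact hu₂O
  have hcond : u₁' ≫ pushout.inl m₁ m₂' = u₂' ≫ pushout.inr m₁ m₂' := by
    rw [← hw₁, ← hw₂, Category.assoc, Category.assoc, pushout.condition]
  exact ⟨{
    X₁' := X₁', X₂' := X₂', X := pushout m₁ m₂', b₁ := b₁, b₂ := b₂, Q₁ := Q₁, Q₂ := Q₂,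
    i₁ := pushout.inl m₁ m₂', i₂ := pushout.inr m₁ m₂',
    g := pushout.desc (b₁ ≫ g₁) (b₂ ≫ g₂) w, u₁' := u₁', u₂' := u₂',
    fg₁ := hQ₁fg, fg₂ := hQ₂fg,
    supp₁ := by rw [hQ₁supp, hO₁, Scheme.Hom.coe_opensRange],
    supp₂ := by rw [hQ₂supp, hO₂, Scheme.Hom.coe_opensRange],
    isBlowup₁ := hb₁, isBlowup₂ := hb₂,
    i₁_g := pushout.inl_desc _ _ _,
    i₂_g := pushout.inr_desc _ _ _,
    u₁'_b₁ := liftOfIsIsoMorphismRestrict_comp _ _ _ _,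
    u₂'_b₂ := liftOfIsIsoMorphismRestrict_comp _ _ _ _,
    u₁'_i₁ := hcond,
    range_i₁_union_range_i₂ := Limits.range_inl_union_range_inr m₁ m₂' }⟩

end Main

end Literature.AlgebraicGeometry.Resolution

end
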